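import Summits.BirchSwinnertonDyer.BirchSwinnertonDyer.Theorems.ErratumRoadFiveEulerHalfNotRamNoInertSetOfHGZ
import Summits.BirchSwinnertonDyer.BirchSwinnertonDyer.Theorems.ErratumRoadFiveEulerHalfModularHGZ
import Summits.BirchSwinnertonDyer.BirchSwinnertonDyer.Theorems.Rank1ResidualJetRingClassFields
import Summits.BirchSwinnertonDyer.Rank1Residual.X11b.BDPRouteTamagawaSupport
import HarnessLib

/-!
# Route `ErratumRoadFive` (K2, `p ≥ 5`), crux `EulerHalfNotRamNoInertSetAtFive` (item stmt-BirchSwinnertonDyer-19715):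
# THE CRUX BY NAME FROM SIX ROUTE ITEMS + Gross 1991 Prop. 3.7 (2) (item 23091) — [GZ86 III (3.1)] (conjunct 2 of item 27981) OUT OF THE CONE
# (cell `bsd-stepL`, width seat `bsd-line-er5-p1-w2` g6; `--supports stmt-BirchSwinnertonDyer-19715 --as helper`)

WHY. `EulerHalfHGZ.eulerHalfNotRamNoInertSetAtFive_of_sixItems_of_frobeniusCongruence_of_hGZOnlyMult` (this seat, `…NoInertSetOfHGZ`, over the re-thread
`…JetchevAtPSupplyOfHGZ` p652455 ∕ `…JetchevAtPSwapEndOfHGZ` p654440 ∕ `…McCallumUpperOfHGZ` p656100 ∕ `…EulerHalfPOnlyMultOfHGZ`) derives the crux from six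
route items + `GrossFrobeniusCongruenceImageFreeFact` + ONE displayed hypothesis, the hGZ receptacle on S1b rows. This file SUPPLIES that receptacle by
name from width seat -w5 g0's «modular aux-norm» `ModularAuxNorm.hGZ_of_onlyMult_of_split_of_dvd_tamagawaProduct` (`…EulerHalfModularHGZ`: the X₀(N)
Heegner family lands in `E⁰` up to a prime-to-`p` multiple at every bad place when `p` is the only multiplicative prime — places over `p` by the
auxiliary-norm lever with -w6 g0's (T)/(C) discharge p648969, places over the additive primes by `12 • P ∈ E₀`), the S1b binder `p ∣ ord_p Δ_min` giving
`p ∣ ∏ c_ℓ` by `X11b.dvd_tamagawaProduct_of_split_of_dvd` and `K[j]` being number fields by `JET.numberField_ringClassField`. Composing: **the crux BY NAME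
from the six route items {19066, 19064, 19524, 19716, 20191, 20442} and item 23091 — conjunct 2 of item 27981 ([GZ86 III (3.1)]
`Gross1991_heegnerPoint_sub_ratTorsion_mem_E0_imageFree`, primary source unheld) is NOT an input of this closer.**

* `hGZOnlyMult_of_modularAuxNorm` — the receptacle on S1b rows, supplied (one term).
* **`eulerHalfNotRamNoInertSetAtFive_of_sixItems_of_frobeniusCongruence (h₅ h₃ hJL hCO hCTi hESi) (hF₁ : GrossFrobeniusCongruenceImageFreeFact) :
  EulerHalfNotRamNoInertSetAtFive`.**

HONEST FRAMING: THEOREMS ONLY (no definition, no named fact, no `sorry`); CONDITIONAL on the SEVEN displayed route items (19064 an open crux; 19066,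
19524, 19716, 20191, 20442 published-input items; 23091 = Gross 1991 Prop. 3.7 (2) image-free, cite-only); item 19715 is NOT closed by this helper
(exact-match close only; the registered `_of` binds 27981) and no stub credit is claimed; no census number moves (404 = 69 + 334 + 1 + 0); BSD is proved
for no curve; no summit statement is touched (T7). Whether the line's `_of` is re-cut over 23091 (v17) is the LEAD's ∕ planner's call.
[cite: GrossLMS1991, Prop. 3.7 (2) (p. 240), §6 (p. 245)] [cite: GrossZagier1986, III (3.1)] [cite: SilvermanATAEC1994, Cor. IV.9.2 (d)]
[cite: Jetchev2008, Thm. 1.4, Cor. 1.5] [cite: McCallumLMS1991, Cor. 5.6] [cite: Cox2013, §9.A]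
-/

set_option autoImplicit false
set_option linter.dupNamespace false -- `Summit.BirchSwinnertonDyer.BirchSwinnertonDyer` (summit = problem), tree-wide

noncomputable section

open scoped Classical NumberField

namespace Summit.BirchSwinnertonDyer.BirchSwinnertonDyer.Theorems.EulerHalfHGZ

open Summit.BirchSwinnertonDyer.BirchSwinnertonDyer.Theses.ErratumRoadFive
open WeierstrassCurve NumberField IsDedekindDomain
open Literature.NumberTheory.EllipticCurves Literature.NumberTheory.EllipticCurves.ModularForms
  Literature.NumberTheory.EllipticCurves.Rank1Residual Literature.NumberTheory.EllipticCurves.Rank1Residual.Typed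
open Summit.BirchSwinnertonDyer.Rank1Residual Summit.BirchSwinnertonDyer.Rank1Residual.X11b
  Summit.BirchSwinnertonDyer.BirchSwinnertonDyer

/-! ### §1 The receptacle on S1b rows, supplied by the modular auxiliary-norm lever -/

/-- **The hGZ receptacle on S1b rows, SUPPLIED** (no [GZ86 III (3.1)]): for every globally minimal `W`, `p ≥ 5`, `(W, p) ∈ X11b`, `ρ̄_{E,p}` onto, `p`
the only multiplicative prime, split at `p` with `p ∣ ord_p Δ_min`, every Heegner field `K` with `d_K < −4` and every conductor frame `(Dt, β, ι)`: the
conclusion of `JET.hGZ_of_Gross1991`. One term: -w5 g0's `ModularAuxNorm.hGZ_of_onlyMult_of_split_of_dvd_tamagawaProduct` with `p ∣ ∏ c_ℓ` from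
`X11b.dvd_tamagawaProduct_of_split_of_dvd` and the `K[j]` number-field instances from `JET.numberField_ringClassField`.
[cite: SilvermanATAEC1994, Cor. IV.9.2 (d)] [cite: GrossLMS1991, §6 (p. 245)] [cite: Cox2013, §9.A] -/
theorem hGZOnlyMult_of_modularAuxNorm :
    ∀ (W : WeierstrassCurve ℚ) [W.IsElliptic] [W.IsGloballyMinimal] (p : ℕ) [Fact p.Prime],
      ClassX11b W p → 5 ≤ p → Surj W p →
      (∀ (ℓ : ℕ) [Fact ℓ.Prime], W.HasMultiplicativeReductionAtPrime ℓ → ℓ = p) →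
      W.HasSplitMultiplicativeReductionAtPrime p → p ∣ padicValInt p W.minimalDiscriminantInt →
      (∀ [NeZero (W.conductorNorm ℤ)] (K : Type) [Field K] [NumberField K], IsImaginaryQuadratic K →
        NumberField.discr K < -4 → SatisfiesHeegnerHypothesis (W.conductorNorm ℤ) K →
        ∀ (Dt : ModularParametrizationData W (W.conductorNorm ℤ)) (β : ℤ) (ι : K →+* ℂ),
        ∃ n' : ℤ, IsCoprime (p : ℤ) n' ∧ ∀ (m : ℕ), Squarefree m →
        (∀ q ∈ m.primeFactors, Zhang2014.IsKolyvaginPrime (W.conductorNorm ℤ) W K p q) →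
        ∀ (dm : KolyvaginHeegnerData Dt β ι m)
          (γ : ringClassField K ι m ≃ₐ[ℚ] ringClassField K ι m), γ ∈ ringClassGal ι m →
          ∀ v : HeightOneSpectrum (𝓞 K), ¬ (W.baseChange K).HasGoodReductionAt v →
            n' • pointsMap (W.baseChange K) (v.adicCompletion K)
                (dm.toGeomPoints (pointGalHom W (ringClassField K ι m) γ dm.y)) ∈
              E0Receptacle (W.baseChange K) v ∧
            ∀ (ℓ : ℕ), ℓ ∈ m.primeFactors → ∀ (dm' : KolyvaginHeegnerData Dt β ι (m / ℓ))
              (hle : ringClassField K ι (m / ℓ) ≤ ringClassField K ι m),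
              n' • pointsMap (W.baseChange K) (v.adicCompletion K)
                  (dm.toGeomPoints (pointGalHom W (ringClassField K ι m) γ
                    (WeierstrassCurve.Affine.Point.map (W' := W)
                      ((RingClassField.inclusion ι hle).restrictScalars ℚ) dm'.y))) ∈
                E0Receptacle (W.baseChange K) v) := by
  intro W _ _ p _ _hX hp5 hsurj honly hsplit hdvd _ K _ _ hK hD hH Dt β ι
  haveI : ∀ j : ℕ, NumberField (ringClassField K ι j) := JET.numberField_ringClassField K hK ι
  exact ModularAuxNorm.hGZ_of_onlyMult_of_split_of_dvd_tamagawaProduct W K hK hD hH p hp5 hsurj honly hsplit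
    (dvd_tamagawaProduct_of_split_of_dvd W hsplit hdvd) Dt β ι

/-! ### §2 The crux from six route items + item 23091 -/

/-- **CRUX 19715 `EulerHalfNotRamNoInertSetAtFive` BY NAME FROM SIX ROUTE ITEMS + `GrossFrobeniusCongruenceImageFreeFact` (item 23091) — conjunct 2 of
item 27981 ([GZ86 III (3.1)]) is NOT an input.** For every X11b pair `(E, p)` with `p ≥ 5`, `ρ̄_{E,p}` onto, no (ram) prime, `p ∣ ∏ c_ℓ` and no inert-set
datum: `Typed.MissingUpperBoundAt E p` — GIVEN `PublishedInputsFive` (19066), `X11aLowerHalf` (19064), `ShimuraParametrizationDataNonempty` (19524),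
`PastenComponentOrdersInput` (19716), `ShimuraCasselsTateLevelInputs` (20191), `ShimuraHeegnerEulerSystemInertPrintedR` (20442),
`GrossFrobeniusCongruenceImageFreeFact` (23091). := `…_of_hGZOnlyMult` fed with §1. CONDITIONAL on the seven items; 19715 stays ledger-`open`; BSD is
proved for no curve. [cite: GrossLMS1991, Prop. 3.7 (2) (p. 240)] [cite: Jetchev2008, Thm. 1.4, Cor. 1.5] [cite: PastenShimura2024, Lemma 6.18, Prop. 6.13] -/
theorem eulerHalfNotRamNoInertSetAtFive_of_sixItems_of_frobeniusCongruence
    (h₅ : PublishedInputsFive) (h₃ : X11aLowerHalf) (hJL : ShimuraParametrizationDataNonempty)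
    (hCO : PastenComponentOrdersInput) (hCTi : ShimuraCasselsTateLevelInputs)
    (hESi : ShimuraHeegnerEulerSystemInertPrintedR) (hF₁ : GrossFrobeniusCongruenceImageFreeFact) :
    EulerHalfNotRamNoInertSetAtFive :=
  eulerHalfNotRamNoInertSetAtFive_of_sixItems_of_frobeniusCongruence_of_hGZOnlyMult h₅ h₃ hJL hCO hCTi hESi hF₁
    hGZOnlyMult_of_modularAuxNorm

end Summit.BirchSwinnertonDyer.BirchSwinnertonDyer.Theorems.EulerHalfHGZ

end
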